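import Summits.Ventures.PercRepro2.CaseOneA2Edge
import Summits.Ventures.PercRepro2.CaseOneDWorldOdds

/-!
# The `b ∈ C₁`-side coefficients of the Q-threshold `(i)` along an `a₂a₃`-edge (blind cell
PercRepro2, p1 g30; the mirror of `CaseOneA2EdgeQB.lean`)

BHK 1.3 in the cleared form `X₀ R₂ − R₀ P₁ ≥ 0` (**`bhk13_cleared`**), the same quantity at the
forced-open `b ∈ C₁`-pair (**`bhk13_forced_open`**: `R₁ = R₀ − R₂`, `X₁ = X₀ − P₁` exactly), and the
Bernstein coefficient `Λᴵ(c⁰, y¹)` of `iExprQ_a2_edge` — `≥ 0` when `(i-Q)` holds for `G − e₂`, by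
`X₀ · Λᴵ(c⁰, y¹) = X₁ · (i-Q)(p₀) + (X₀ R₁ − X₁ R₀)(X₀ P₃ − Dqo₀ P₁)` with BHK 1.3 and `odds_q`
(**`lamQI_c0_y1_nonneg`**). Own code; standard axioms.
-/

namespace Summit.Ventures.PercRepro2

namespace CaseOne

section IB
variable {V : Type*} {E : Type*} [Fintype E] [DecidableEq E] [Fintype V] [DecidableEq V]
  {R : Type*} [Field R] [LinearOrder R] [IsStrictOrderedRing R]
variable {ends : E → Sym2 V} {a₁ a₂ a₃ : V} {e₂ : E}

/-- BHK 1.3 in the cleared form `X₀ R₂ − R₀ P₁ ≥ 0`. -/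
lemma bhk13_cleared (p : E → R) (hp : IsProbVec p) (b : V) :
    0 ≤ prob p (connEvent ends a₁ a₂)ᶜ *
        prob p (connEvent ends a₁ b ∩ connEvent ends a₁ a₃ ∩ (connEvent ends a₁ a₂)ᶜ) -
      prob p (connEvent ends a₁ b ∩ (connEvent ends a₁ a₂)ᶜ) *
        prob p (connEvent ends a₁ a₃ ∩ (connEvent ends a₁ a₂)ᶜ) := by
  have hbhk := bhk_same_cluster_events p hp ends a₁ a₂ (isUpperSet_mem_setOf b)
    (isUpperSet_mem_setOf a₃)
  rw [← connEvent_eq_clusterInEvent ends a₁ b, ← connEvent_eq_clusterInEvent ends a₁ a₃] at hbhk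
  linarith

/-- BHK 1.3 at the forced-open `b ∈ C₁`-pair: `X₁ R₂ − R₁ P₁ = X₀ R₂ − R₀ P₁ ≥ 0`. -/
lemma bhk13_forced_open (p : E → R) (hp : IsProbVec p) (he : ends e₂ = s(a₂, a₃)) (b : V) :
    0 ≤ prob (Function.update p e₂ 1) (connEvent ends a₁ a₂)ᶜ *
        prob (Function.update p e₂ 0) (connEvent ends a₁ b ∩ connEvent ends a₁ a₃ ∩
          (connEvent ends a₁ a₂)ᶜ) -
      prob (Function.update p e₂ 1) (connEvent ends a₁ b ∩ (connEvent ends a₁ a₂)ᶜ) *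
        prob (Function.update p e₂ 0) (connEvent ends a₁ a₃ ∩ (connEvent ends a₁ a₂)ᶜ) := by
  have h0 := bhk13_cleared (ends := ends) (a₁ := a₁) (a₂ := a₂) (a₃ := a₃) (Function.update p e₂ 0)
    (hp.update e₂ le_rfl zero_le_one) b
  rw [prob_Q_update_one (a₁ := a₁) p he, prob_QB1_update_one (a₁ := a₁) p he b]
  linarith

/-- **The coefficient `Λᴵ(c⁰, y¹)` is nonnegative** when `(i-Q)` holds for `G − e₂`. -/
theorem lamQI_c0_y1_nonneg (p : E → R) (hp : IsProbVec p) (he : ends e₂ = s(a₂, a₃)) (o b : V)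
    (hQ : ZSplitIQ (Function.update p e₂ 0) ends o a₁ a₂ a₃ b) :
    0 ≤ -(prob (Function.update p e₂ 0) (connEvent ends a₁ a₂)ᶜ *
        (prob (Function.update p e₂ 1) (connEvent ends a₁ a₂)ᶜ *
          prob (Function.update p e₂ 0) (connEvent ends a₁ b ∩ connEvent ends a₁ a₃ ∩
            connEvent ends a₂ o ∩ (connEvent ends a₁ a₂)ᶜ) -
        prob (Function.update p e₂ 1) (connEvent ends a₁ b ∩ (connEvent ends a₁ a₂)ᶜ) *
          prob (Function.update p e₂ 0) (connEvent ends a₁ a₃ ∩ connEvent ends a₂ o ∩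
            (connEvent ends a₁ a₂)ᶜ))) +
      Dqo (Function.update p e₂ 0) ends o a₁ a₂ *
        (prob (Function.update p e₂ 1) (connEvent ends a₁ a₂)ᶜ *
          prob (Function.update p e₂ 0) (connEvent ends a₁ b ∩ connEvent ends a₁ a₃ ∩
            (connEvent ends a₁ a₂)ᶜ) -
        prob (Function.update p e₂ 1) (connEvent ends a₁ b ∩ (connEvent ends a₁ a₂)ᶜ) *
          prob (Function.update p e₂ 0) (connEvent ends a₁ a₃ ∩ (connEvent ends a₁ a₂)ᶜ)) := by
  unfold ZSplitIQ at hQ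
  rw [iExprT_eq] at hQ
  set p₀ := Function.update p e₂ 0 with hp₀
  set p₁ := Function.update p e₂ 1 with hp₁
  have hp0 : IsProbVec p₀ := hp.update e₂ le_rfl zero_le_one
  have hp1 : IsProbVec p₁ := hp.update e₂ zero_le_one le_rfl
  have hsign := a2_b1Threshold_nonpos (a₁ := a₁) p hp he b
  have hodds := odds_q p₀ hp0 ends o a₁ a₂ a₃
  have hX1 : 0 ≤ prob p₁ (connEvent ends a₁ a₂)ᶜ := prob_nonneg hp1 _
  have hX0 : 0 ≤ prob p₀ (connEvent ends a₁ a₂)ᶜ := prob_nonneg hp0 _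
  set T := -(prob p₀ (connEvent ends a₁ a₂)ᶜ *
        (prob p₁ (connEvent ends a₁ a₂)ᶜ *
          prob p₀ (connEvent ends a₁ b ∩ connEvent ends a₁ a₃ ∩ connEvent ends a₂ o ∩
            (connEvent ends a₁ a₂)ᶜ) -
        prob p₁ (connEvent ends a₁ b ∩ (connEvent ends a₁ a₂)ᶜ) *
          prob p₀ (connEvent ends a₁ a₃ ∩ connEvent ends a₂ o ∩ (connEvent ends a₁ a₂)ᶜ))) +
      Dqo p₀ ends o a₁ a₂ *
        (prob p₁ (connEvent ends a₁ a₂)ᶜ *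
          prob p₀ (connEvent ends a₁ b ∩ connEvent ends a₁ a₃ ∩ (connEvent ends a₁ a₂)ᶜ) -
        prob p₁ (connEvent ends a₁ b ∩ (connEvent ends a₁ a₂)ᶜ) *
          prob p₀ (connEvent ends a₁ a₃ ∩ (connEvent ends a₁ a₂)ᶜ)) with hT
  -- `X₀ · T = X₁ · (i-Q)(p₀) + (X₀ R₁ − X₁ R₀)(X₀ P₃ − Dqo₀ P₁)`
  have key : prob p₀ (connEvent ends a₁ a₂)ᶜ * T =
      prob p₁ (connEvent ends a₁ a₂)ᶜ *
        (-(prob p₀ (connEvent ends a₁ a₂)ᶜ *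
          (prob p₀ (connEvent ends a₁ a₂)ᶜ *
            prob p₀ (connEvent ends a₁ b ∩ connEvent ends a₁ a₃ ∩ connEvent ends a₂ o ∩
              (connEvent ends a₁ a₂)ᶜ) -
          prob p₀ (connEvent ends a₁ b ∩ (connEvent ends a₁ a₂)ᶜ) *
            prob p₀ (connEvent ends a₁ a₃ ∩ connEvent ends a₂ o ∩ (connEvent ends a₁ a₂)ᶜ))) +
        Dqo p₀ ends o a₁ a₂ *
          (prob p₀ (connEvent ends a₁ a₂)ᶜ *
            prob p₀ (connEvent ends a₁ b ∩ connEvent ends a₁ a₃ ∩ (connEvent ends a₁ a₂)ᶜ) -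
          prob p₀ (connEvent ends a₁ b ∩ (connEvent ends a₁ a₂)ᶜ) *
            prob p₀ (connEvent ends a₁ a₃ ∩ (connEvent ends a₁ a₂)ᶜ))) +
      (prob p₀ (connEvent ends a₁ a₂)ᶜ * prob p₁ (connEvent ends a₁ b ∩ (connEvent ends a₁ a₂)ᶜ) -
        prob p₁ (connEvent ends a₁ a₂)ᶜ * prob p₀ (connEvent ends a₁ b ∩ (connEvent ends a₁ a₂)ᶜ)) *
      (prob p₀ (connEvent ends a₁ a₂)ᶜ *
          prob p₀ (connEvent ends a₁ a₃ ∩ connEvent ends a₂ o ∩ (connEvent ends a₁ a₂)ᶜ) -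
        Dqo p₀ ends o a₁ a₂ * prob p₀ (connEvent ends a₁ a₃ ∩ (connEvent ends a₁ a₂)ᶜ)) := by
    rw [hT]; ring
  rcases eq_or_lt_of_le hX0 with hX0' | hX0'
  · have hz : ∀ Y : Set (Config E), Y ⊆ (connEvent ends a₁ a₂)ᶜ → prob p₀ Y = 0 := fun Y hY =>
      le_antisymm (by rw [hX0']; exact prob_mono hp0 hY) (prob_nonneg hp0 Y)
    have z4 : prob p₀ (connEvent ends a₁ b ∩ connEvent ends a₁ a₃ ∩ connEvent ends a₂ o ∩
        (connEvent ends a₁ a₂)ᶜ) = 0 := hz _ (fun _ h => h.2)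
    have z3 : prob p₀ (connEvent ends a₁ a₃ ∩ connEvent ends a₂ o ∩ (connEvent ends a₁ a₂)ᶜ) = 0 :=
      hz _ (fun _ h => h.2)
    have z2 : prob p₀ (connEvent ends a₁ b ∩ connEvent ends a₁ a₃ ∩ (connEvent ends a₁ a₂)ᶜ) = 0 :=
      hz _ (fun _ h => h.2)
    have z1 : prob p₀ (connEvent ends a₁ a₃ ∩ (connEvent ends a₁ a₂)ᶜ) = 0 := hz _ (fun _ h => h.2)
    rw [hT, z4, z3, z2, z1]
    simp
  · have hodds' : prob p₀ (connEvent ends a₁ a₂)ᶜ *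
          prob p₀ (connEvent ends a₁ a₃ ∩ connEvent ends a₂ o ∩ (connEvent ends a₁ a₂)ᶜ) -
        Dqo p₀ ends o a₁ a₂ * prob p₀ (connEvent ends a₁ a₃ ∩ (connEvent ends a₁ a₂)ᶜ) ≤ 0 := by
      linarith [hodds]
    have hprod := mul_nonneg_of_nonpos_of_nonpos hsign hodds'
    have hrhs := add_nonneg (mul_nonneg hX1 hQ) hprod
    rw [← key] at hrhs
    exact nonneg_of_mul_nonneg_right hrhs hX0'

end IB

end CaseOne

end Summit.Ventures.PercRepro2
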